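import Summits.QuantumFields.YangMills.Theorems.LangevinControlUVOSLegsFromFemtoAndGapStubAssemblyShiftedBound
import HarnessLib

/-!
# Soft OS-assembly toolkit XVI: the shift defect `Σₓ W(x) (G(y(x) + c) − G(y(x))) = O(a)`

Helper file for stub `stub_assembly6` of crux `OSLegsFromFemtoAndGap` (stmt-QuantumFields-9367, line
`dlr-collar-transfer`, reshape r2).  Lattice reflections act on plaquette strings exactly up to per-argument
shifts of one lattice unit; after the change of variables the reflection-positivity square and the OS form
differ by sums `Σₓ W(x) (G(y(x) + c) − G(y(x)))` with a constant shift vector `c`, `‖c_l‖ ≤ a`.  Such a sum is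
`O(a)`: by the mean value theorem (real and imaginary parts separately) each difference is a directional
derivative `∂_c G` at an intermediate SHIFTED point, `∂_c G ∈ ⁰𝒮` when `G ∈ ⁰𝒮` (`IsOffDiagonal.lineDeriv`),
its seminorms are `≤ ‖c‖ ×` those of `G` of one order more (`seminorm_lineDeriv_le`), and toolkit X-b's absolute
bound applies at the intermediate points (`norm_sum_weight_shift_sub_le`).
-/

noncomputable section

open scoped SchwartzMap BigOperators LineDeriv
open MeasureTheory Filter Topology Set
open Literature.MathematicalPhysics.QuantumFieldTheory Literature.MathematicalPhysics.QuantumLattice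
open Literature.MathematicalPhysics.AQFT
open Literature.Probability.LatticeModels (box Site)

namespace Summit.QuantumFields.YangMills.Theorems.OSLegsFromFemtoAndGap

local notation "E4" => EuclideanSpace ℝ (Fin 4)

section General

variable {V : Type*} [NormedAddCommGroup V] [NormedSpace ℝ V]

/-- `‖Dʲ(∂_e G)(x)‖ ≤ ‖e‖ ‖Dʲ⁺¹G(x)‖` for a Schwartz map. -/
theorem norm_iteratedFDeriv_lineDeriv_le (G : 𝓢(V, ℂ)) (e : V) (j : ℕ) (x : V) :
    ‖iteratedFDeriv ℝ j (∂_{e} G : 𝓢(V, ℂ)) x‖ ≤ ‖e‖ * ‖iteratedFDeriv ℝ (j + 1) G x‖ := by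
  have hfun : ((∂_{e} G : 𝓢(V, ℂ)) : V → ℂ) =
      (ContinuousLinearMap.apply ℝ ℂ e) ∘ (fderiv ℝ (G : V → ℂ)) := by
    funext y; simp [SchwartzMap.lineDerivOp_apply_eq_fderiv]
  have hg : ContDiff ℝ j (fderiv ℝ (G : V → ℂ)) :=
    (G.smooth (j + 1)).fderiv_right (m := j) le_rfl
  rw [hfun, ContinuousLinearMap.iteratedFDeriv_comp_left _ hg.contDiffAt (i := j) le_rfl]
  calc _ ≤ ‖ContinuousLinearMap.apply ℝ ℂ e‖ * ‖iteratedFDeriv ℝ j (fderiv ℝ (G : V → ℂ)) x‖ :=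
        ContinuousLinearMap.norm_compContinuousMultilinearMap_le _ _
    _ ≤ ‖e‖ * ‖iteratedFDeriv ℝ (j + 1) G x‖ := by
        rw [norm_iteratedFDeriv_fderiv]
        gcongr
        exact ContinuousLinearMap.opNorm_le_bound _ (norm_nonneg e) fun f => by
          rw [ContinuousLinearMap.apply_apply, mul_comm]; exact f.le_opNorm e

/-- `p_{k,j}(∂_e G) ≤ ‖e‖ p_{k,j+1}(G)`. -/
theorem seminorm_lineDeriv_le (G : 𝓢(V, ℂ)) (e : V) (k j : ℕ) :
    SchwartzMap.seminorm ℂ k j (∂_{e} G : 𝓢(V, ℂ)) ≤ ‖e‖ * SchwartzMap.seminorm ℂ k (j + 1) G := by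
  refine SchwartzMap.seminorm_le_bound ℂ k j _ (by positivity) fun x => ?_
  calc ‖x‖ ^ k * ‖iteratedFDeriv ℝ j (∂_{e} G : 𝓢(V, ℂ)) x‖ ≤ ‖x‖ ^ k * (‖e‖ * ‖iteratedFDeriv ℝ (j + 1) G x‖) := by
        gcongr; exact norm_iteratedFDeriv_lineDeriv_le G e j x
    _ = ‖e‖ * (‖x‖ ^ k * ‖iteratedFDeriv ℝ (j + 1) G x‖) := by ring
    _ ≤ ‖e‖ * SchwartzMap.seminorm ℂ k (j + 1) G := by
        gcongr; exact SchwartzMap.le_seminorm ℂ k (j + 1) G x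

/-- **Mean value along a segment, real part**: `Re G(y + c) − Re G(y) = Re ∂_c G(y + τc)` for some `τ ∈ (0,1)`. -/
theorem exists_re_sub_eq_re_lineDeriv (G : 𝓢(V, ℂ)) (y c : V) :
    ∃ τ ∈ Ioo (0 : ℝ) 1, (G (y + c)).re - (G y).re = ((∂_{c} G : 𝓢(V, ℂ)) (y + τ • c)).re := by
  set φ : ℝ → ℝ := fun t => (G (y + t • c)).re with hφ
  have hderiv : ∀ t, HasDerivAt φ ((fderiv ℝ (G : V → ℂ) (y + t • c) c).re) t := by
    intro t
    have hℓ : HasDerivAt (fun t : ℝ => y + t • c) c t := by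
      simpa using ((hasDerivAt_id t).smul_const c).const_add y
    have hG : HasDerivAt (fun t : ℝ => G (y + t • c)) (fderiv ℝ (G : V → ℂ) (y + t • c) c) t :=
      (G.hasFDerivAt (y + t • c)).comp_hasDerivAt t hℓ
    exact (Complex.reCLM.hasFDerivAt.comp_hasDerivAt t hG)
  obtain ⟨τ, hτ, h⟩ := exists_hasDerivAt_eq_slope φ (fun t => (fderiv ℝ (G : V → ℂ) (y + t • c) c).re)
    zero_lt_one (fun t _ => (hderiv t).continuousAt.continuousWithinAt) (fun t _ => hderiv t)
  refine ⟨τ, hτ, ?_⟩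
  rw [SchwartzMap.lineDerivOp_apply_eq_fderiv, h]
  simp [hφ]

/-- **Mean value along a segment, imaginary part.** -/
theorem exists_im_sub_eq_im_lineDeriv (G : 𝓢(V, ℂ)) (y c : V) :
    ∃ τ ∈ Ioo (0 : ℝ) 1, (G (y + c)).im - (G y).im = ((∂_{c} G : 𝓢(V, ℂ)) (y + τ • c)).im := by
  set φ : ℝ → ℝ := fun t => (G (y + t • c)).im with hφ
  have hderiv : ∀ t, HasDerivAt φ ((fderiv ℝ (G : V → ℂ) (y + t • c) c).im) t := by
    intro t
    have hℓ : HasDerivAt (fun t : ℝ => y + t • c) c t := by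
      simpa using ((hasDerivAt_id t).smul_const c).const_add y
    have hG : HasDerivAt (fun t : ℝ => G (y + t • c)) (fderiv ℝ (G : V → ℂ) (y + t • c) c) t :=
      (G.hasFDerivAt (y + t • c)).comp_hasDerivAt t hℓ
    exact (Complex.imCLM.hasFDerivAt.comp_hasDerivAt t hG)
  obtain ⟨τ, hτ, h⟩ := exists_hasDerivAt_eq_slope φ (fun t => (fderiv ℝ (G : V → ℂ) (y + t • c) c).im)
    zero_lt_one (fun t _ => (hderiv t).continuousAt.continuousWithinAt) (fun t _ => hderiv t)
  refine ⟨τ, hτ, ?_⟩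
  rw [SchwartzMap.lineDerivOp_apply_eq_fderiv, h]
  simp [hφ]

/-- **Per-point mean value bound**: `‖G(y + c) − G(y)‖ ≤ ‖∂_c G(y + τ₁ c)‖ + ‖∂_c G(y + τ₂ c)‖`. -/
theorem norm_sub_le_lineDeriv (G : 𝓢(V, ℂ)) (y c : V) :
    ∃ τ₁ ∈ Ioo (0 : ℝ) 1, ∃ τ₂ ∈ Ioo (0 : ℝ) 1,
      ‖G (y + c) - G y‖ ≤ ‖(∂_{c} G : 𝓢(V, ℂ)) (y + τ₁ • c)‖ + ‖(∂_{c} G : 𝓢(V, ℂ)) (y + τ₂ • c)‖ := by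
  obtain ⟨τ₁, hτ₁, h₁⟩ := exists_re_sub_eq_re_lineDeriv G y c
  obtain ⟨τ₂, hτ₂, h₂⟩ := exists_im_sub_eq_im_lineDeriv G y c
  refine ⟨τ₁, hτ₁, τ₂, hτ₂, ?_⟩
  have hre : |(G (y + c) - G y).re| ≤ ‖(∂_{c} G : 𝓢(V, ℂ)) (y + τ₁ • c)‖ := by
    rw [Complex.sub_re, h₁]; exact Complex.abs_re_le_norm _
  have him : |(G (y + c) - G y).im| ≤ ‖(∂_{c} G : 𝓢(V, ℂ)) (y + τ₂ • c)‖ := by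
    rw [Complex.sub_im, h₂]; exact Complex.abs_im_le_norm _
  calc ‖G (y + c) - G y‖ ≤ |(G (y + c) - G y).re| + |(G (y + c) - G y).im| := Complex.norm_le_abs_re_add_abs_im _
    _ ≤ _ := add_le_add hre him

end General

variable {n : ℕ}

/-- **`⁰𝒮` is stable under directional derivatives.** -/
theorem _root_.Literature.MathematicalPhysics.AQFT.IsOffDiagonal.lineDeriv {F : 𝓢((Fin n → E4), ℂ)}
    (hF : IsOffDiagonal F) (e : Fin n → E4) : IsOffDiagonal (∂_{e} F : 𝓢((Fin n → E4), ℂ)) := by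
  intro x hx j
  have hfun : ((∂_{e} F : 𝓢((Fin n → E4), ℂ)) : (Fin n → E4) → ℂ) =
      (ContinuousLinearMap.apply ℝ ℂ e) ∘ (fderiv ℝ (F : (Fin n → E4) → ℂ)) := by
    funext y; simp [SchwartzMap.lineDerivOp_apply_eq_fderiv]
  have hg : ContDiff ℝ j (fderiv ℝ (F : (Fin n → E4) → ℂ)) := (F.smooth (j + 1)).fderiv_right (m := j) le_rfl
  rw [hfun, ContinuousLinearMap.iteratedFDeriv_comp_left _ hg.contDiffAt (i := j) le_rfl]
  have h0 : iteratedFDeriv ℝ j (fderiv ℝ (F : (Fin n → E4) → ℂ)) x = 0 := by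
    have h1 := hF x hx (j + 1)
    rw [iteratedFDeriv_succ_eq_comp_right, Function.comp_apply, LinearIsometryEquiv.map_eq_zero_iff] at h1
    exact h1
  rw [h0]
  ext v
  simp

/-- The seminorm budget of the directional derivative. -/
theorem budget_lineDeriv_le (F : 𝓢((Fin n → E4), ℂ)) (e : Fin n → E4) :
    SchwartzMap.seminorm ℂ 0 (4 * n) (∂_{e} F : 𝓢((Fin n → E4), ℂ)) +
        SchwartzMap.seminorm ℂ (6 * n) (4 * n) (∂_{e} F : 𝓢((Fin n → E4), ℂ)) +
        SchwartzMap.seminorm ℂ 0 0 (∂_{e} F : 𝓢((Fin n → E4), ℂ)) +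
        SchwartzMap.seminorm ℂ (6 * n) 0 (∂_{e} F : 𝓢((Fin n → E4), ℂ)) +
        SchwartzMap.seminorm ℂ (10 * n) 0 (∂_{e} F : 𝓢((Fin n → E4), ℂ)) ≤
      ‖e‖ * (SchwartzMap.seminorm ℂ 0 (4 * n + 1) F + SchwartzMap.seminorm ℂ (6 * n) (4 * n + 1) F +
        SchwartzMap.seminorm ℂ 0 1 F + SchwartzMap.seminorm ℂ (6 * n) 1 F + SchwartzMap.seminorm ℂ (10 * n) 1 F) := by
  have h1 := seminorm_lineDeriv_le F e 0 (4 * n)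
  have h2 := seminorm_lineDeriv_le F e (6 * n) (4 * n)
  have h3 := seminorm_lineDeriv_le F e 0 0
  have h4 := seminorm_lineDeriv_le F e (6 * n) 0
  have h5 := seminorm_lineDeriv_le F e (10 * n) 0
  linarith

/-- **The shift defect is `O(a)`.**  Abstract weights `W` (sup bound `Mⁿ`, collar bound), base points `y(x)` within
`s₁ a` of `a x`, a constant shift `c` with `‖c_l‖ ≤ s₂ a`, `s₁ + s₂ ≤ 6`, `(s₁ + s₂) a ≤ 1/4`, `G ∈ ⁰𝒮ₙ`:
`‖Σₓ W(x) (G(y(x) + c) − G(y(x)))‖ ≤ 2 ‖c‖ Kⁿ Σ⁺(G)`, `Σ⁺` the seminorm budget of one more derivative. -/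
theorem norm_sum_weight_shift_sub_le {C ℓ₄ M a s₁ s₂ : ℝ} {L : ℕ} (hℓ : 0 < ℓ₄) (hC : 0 ≤ C) (hM : 0 ≤ M)
    (W : (Fin n → Site 4) → ℝ) (hWsup : ∀ x, |W x| ≤ M ^ n)
    (H : ∀ (x : Fin n → Site 4) (R : ℕ), 1 ≤ R → (R : ℝ) * a ≤ ℓ₄ → 4 * R + 8 ≤ L →
      (∀ i j : Fin n, i ≠ j → ∃ k : Fin 4,
        (2 * (R : ℤ) + 4) ≤ |((((x i k - x j k : ℤ) : ZMod (2 * L + 1))).valMinAbs : ℤ)|) →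
      |W x| ≤ (C / (R : ℝ) ^ 4) ^ n)
    (ha : 0 < a) (ha1 : a ≤ 1) (haℓ : a ≤ ℓ₄) (hL14 : 14 ≤ L) (hLa : a⁻¹ * a⁻¹ ≤ L) (hn : 2 ≤ n)
    (hs₁ : 0 ≤ s₁) (hs₂ : 0 ≤ s₂) (hs6 : s₁ + s₂ ≤ 6) (hsa : (s₁ + s₂) * a ≤ 1 / 4)
    (G : 𝓢((Fin n → E4), ℂ)) (hG : IsOffDiagonal G)
    (y : (Fin n → Site 4) → (Fin n → E4)) (hyx : ∀ x l, ‖y x l - a • siteToE (x l)‖ ≤ s₁ * a)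
    (c : Fin n → E4) (hc : ∀ l, ‖c l‖ ≤ s₂ * a) :
    ‖∑ x ∈ Fintype.piFinset (fun _ : Fin n => box 4 L), ((W x : ℝ) : ℂ) * (G (y x + c) - G (y x))‖ ≤
      2 * ‖c‖ * ((M * 4 ^ 4 * 5 ^ 6 + M * 2 ^ 6 * (10 + 2 * (s₁ + s₂)) ^ 4 + 16 * C * 2 ^ 6 * (2 / ℓ₄ + 48) ^ 4) *
          2 ^ 6 * (81 * ∑' m : ℕ, (((m : ℝ) + 1) ^ 2)⁻¹)) ^ n *
        (SchwartzMap.seminorm ℂ 0 (4 * n + 1) G + SchwartzMap.seminorm ℂ (6 * n) (4 * n + 1) G +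
          SchwartzMap.seminorm ℂ 0 1 G + SchwartzMap.seminorm ℂ (6 * n) 1 G + SchwartzMap.seminorm ℂ (10 * n) 1 G) := by
  classical
  -- intermediate points, chosen per lattice point
  have hmv := fun x : Fin n → Site 4 => norm_sub_le_lineDeriv G (y x) c
  choose τ₁ hτ₁ τ₂ hτ₂ hle using hmv
  -- the intermediate points are within `(s₁ + s₂) a` of `a x`
  have hshift : ∀ (τ : (Fin n → Site 4) → ℝ), (∀ x, τ x ∈ Ioo (0 : ℝ) 1) →
      ∀ x l, ‖(y x + τ x • c) l - a • siteToE (x l)‖ ≤ (s₁ + s₂) * a := by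
    intro τ hτ x l
    have h1 : (y x + τ x • c) l - a • siteToE (x l) = (y x l - a • siteToE (x l)) + τ x • c l := by
      simp only [Pi.add_apply, Pi.smul_apply]; abel
    rw [h1]
    calc _ ≤ ‖y x l - a • siteToE (x l)‖ + ‖τ x • c l‖ := norm_add_le _ _
      _ ≤ s₁ * a + s₂ * a := by
          refine add_le_add (hyx x l) ?_
          rw [norm_smul, Real.norm_of_nonneg (hτ x).1.le]
          calc τ x * ‖c l‖ ≤ 1 * ‖c l‖ := by gcongr; exact (hτ x).2.le
            _ ≤ s₂ * a := by rw [one_mul]; exact hc l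
      _ = (s₁ + s₂) * a := by ring
  have hG' : IsOffDiagonal (∂_{c} G : 𝓢((Fin n → E4), ℂ)) := hG.lineDeriv c
  have hs0 : 0 ≤ s₁ + s₂ := by positivity
  have hsum₁ := sum_abs_weight_mul_norm_le hℓ hC hM W hWsup H ha ha1 haℓ hL14 hLa hn hs0 hs6 hsa
    (∂_{c} G : 𝓢((Fin n → E4), ℂ)) hG' (fun x => y x + τ₁ x • c) (hshift τ₁ hτ₁)
  have hsum₂ := sum_abs_weight_mul_norm_le hℓ hC hM W hWsup H ha ha1 haℓ hL14 hLa hn hs0 hs6 hsa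
    (∂_{c} G : 𝓢((Fin n → E4), ℂ)) hG' (fun x => y x + τ₂ x • c) (hshift τ₂ hτ₂)
  set KK := ((M * 4 ^ 4 * 5 ^ 6 + M * 2 ^ 6 * (10 + 2 * (s₁ + s₂)) ^ 4 + 16 * C * 2 ^ 6 * (2 / ℓ₄ + 48) ^ 4) *
    2 ^ 6 * (81 * ∑' m : ℕ, (((m : ℝ) + 1) ^ 2)⁻¹)) ^ n with hKK
  have hKK0 : 0 ≤ KK := by
    have : 0 ≤ ∑' m : ℕ, (((m : ℝ) + 1) ^ 2)⁻¹ := tsum_nonneg fun m => by positivity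
    positivity
  have hbud := budget_lineDeriv_le G c
  calc ‖∑ x ∈ Fintype.piFinset (fun _ : Fin n => box 4 L), ((W x : ℝ) : ℂ) * (G (y x + c) - G (y x))‖
      ≤ ∑ x ∈ Fintype.piFinset (fun _ : Fin n => box 4 L), ‖((W x : ℝ) : ℂ) * (G (y x + c) - G (y x))‖ :=
        norm_sum_le _ _
    _ ≤ ∑ x ∈ Fintype.piFinset (fun _ : Fin n => box 4 L),
        (|W x| * ‖(∂_{c} G : 𝓢((Fin n → E4), ℂ)) (y x + τ₁ x • c)‖ +
          |W x| * ‖(∂_{c} G : 𝓢((Fin n → E4), ℂ)) (y x + τ₂ x • c)‖) := by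
        refine Finset.sum_le_sum fun x _ => ?_
        rw [norm_mul, Complex.norm_real, Real.norm_eq_abs, ← mul_add]
        exact mul_le_mul_of_nonneg_left (hle x) (abs_nonneg _)
    _ = (∑ x ∈ Fintype.piFinset (fun _ : Fin n => box 4 L), |W x| * ‖(∂_{c} G : 𝓢((Fin n → E4), ℂ)) (y x + τ₁ x • c)‖) +
        ∑ x ∈ Fintype.piFinset (fun _ : Fin n => box 4 L), |W x| * ‖(∂_{c} G : 𝓢((Fin n → E4), ℂ)) (y x + τ₂ x • c)‖ :=
        Finset.sum_add_distrib
    _ ≤ KK * (SchwartzMap.seminorm ℂ 0 (4 * n) (∂_{c} G : 𝓢((Fin n → E4), ℂ)) +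
          SchwartzMap.seminorm ℂ (6 * n) (4 * n) (∂_{c} G : 𝓢((Fin n → E4), ℂ)) +
          SchwartzMap.seminorm ℂ 0 0 (∂_{c} G : 𝓢((Fin n → E4), ℂ)) +
          SchwartzMap.seminorm ℂ (6 * n) 0 (∂_{c} G : 𝓢((Fin n → E4), ℂ)) +
          SchwartzMap.seminorm ℂ (10 * n) 0 (∂_{c} G : 𝓢((Fin n → E4), ℂ))) +
        KK * (SchwartzMap.seminorm ℂ 0 (4 * n) (∂_{c} G : 𝓢((Fin n → E4), ℂ)) +
          SchwartzMap.seminorm ℂ (6 * n) (4 * n) (∂_{c} G : 𝓢((Fin n → E4), ℂ)) +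
          SchwartzMap.seminorm ℂ 0 0 (∂_{c} G : 𝓢((Fin n → E4), ℂ)) +
          SchwartzMap.seminorm ℂ (6 * n) 0 (∂_{c} G : 𝓢((Fin n → E4), ℂ)) +
          SchwartzMap.seminorm ℂ (10 * n) 0 (∂_{c} G : 𝓢((Fin n → E4), ℂ))) := add_le_add hsum₁ hsum₂
    _ ≤ KK * (‖c‖ * (SchwartzMap.seminorm ℂ 0 (4 * n + 1) G + SchwartzMap.seminorm ℂ (6 * n) (4 * n + 1) G +
          SchwartzMap.seminorm ℂ 0 1 G + SchwartzMap.seminorm ℂ (6 * n) 1 G + SchwartzMap.seminorm ℂ (10 * n) 1 G)) +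
        KK * (‖c‖ * (SchwartzMap.seminorm ℂ 0 (4 * n + 1) G + SchwartzMap.seminorm ℂ (6 * n) (4 * n + 1) G +
          SchwartzMap.seminorm ℂ 0 1 G + SchwartzMap.seminorm ℂ (6 * n) 1 G + SchwartzMap.seminorm ℂ (10 * n) 1 G)) := by
        gcongr
    _ = _ := by ring

end Summit.QuantumFields.YangMills.Theorems.OSLegsFromFemtoAndGap

end
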